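import Mathlib.NumberTheory.ArithmeticFunction.Misc
import Mathlib.NumberTheory.Harmonic.EulerMascheroni
import Mathlib.Analysis.Complex.ExponentialBounds
import Mathlib.Tactic.NormNum.Prime
import HarnessLib

/-!
# Lagarias's inequality for `n ≤ 5040`: the certified computation (Lagarias 2002, §3)

Topic: `Literature/NumberTheory/LFunctions`. Lagarias's criterion (`Literature.NumberTheory.LFunctions.lagarias_iff`,
Lagarias 2002, Thm. 1.1) is "RH ↔ `σ(n) ≤ H_n + exp(H_n) log(H_n)` for all `n ≥ 1`". Its proof
(§3 of the paper) treats `n ≥ 5041` analytically (Robin's theorem) and says, for the rest: "For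
`1 ≤ n ≤ 5040` one verifies (1.1) directly by computer, the only case of equality being `n = 1`"
(computation credited to E. Rains). This file is that computer verification, carried out inside
Lean's kernel (no `native_decide`, no extra axioms):

* `Literature.NumberTheory.LFunctions.sigma_le_harmonic_add_exp_mul_log_of_le_5040` — for `1 ≤ n ≤ 5040`,
  `σ(n) ≤ H_n + exp(H_n) log(H_n)` (`σ = ArithmeticFunction.sigma 1`, `H_n = harmonic n`).

It discharges the computational named fact `Literature.NumberTheory.LFunctions.Lagarias2002_numerical_le_5040` of
`LagariasCriterion.lean` (the discharge `…_holds` is a one-liner there once both files are in the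
tree; this file deliberately does not import that one).

## Method

The right-hand side `f(n) = H_n + exp(H_n) log(H_n)` is transcendental, so the check is split
into an exact integer computation and sixteen certified real inequalities.

1. *Linear lower bounds for `f` from checkpoints.* `exp(H_n)/(n+1)` is non-decreasing in `n`
   (`exp(1/(n+1)) ≥ 1 + 1/(n+1)`), so for `n ≥ m`,
   `f(n) ≥ H_m + exp(H_m) log(H_m) · (n+1)/(m+1)`. Given rationals `h ≤ H_m`, `a ≤ exp h`,
   `0 ≤ b ≤ log h`, this gives `f(n) ≥ h + a b (n+1)/(m+1)` for all `n ≥ m`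
   (`Literature.NumberTheory.LFunctions.LagariasNumerical.bound_of_checkpoint`).
2. *Certified constants.* `a ≤ exp h` and `exp b ≤ h` are reduced to closed rational
   inequalities by `exp(j + y) ≥ 2.7182818283^j · Σ_{i<12} yⁱ/i!` (`Real.exp_one_gt_d9`,
   `Real.sum_le_exp_of_nonneg`) and `exp(j + y) ≤ 2.7182818286^j · (Σ_{i<12} yⁱ/i! +
   13 y¹²/(12!·12))` for `0 ≤ y ≤ 1` (`Real.exp_one_lt_d9`, `Real.exp_bound'`), then `norm_num`.
   `h ≤ H_m` is exact for `m ≤ 60` (unfolding `harmonic`), and for `m > 60` uses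
   `H_m ≥ H_60 + log((m+1)/61)` (monotonicity of `Real.eulerMascheroniSeq n = H_n − log(n+1)`).
3. *The integer check.* With `D = 10⁴` and sixteen rows `(m, E, F)` (`m` = 1, 2, 3, 4, 6, 12,
   24, 36, 60, 120, 180, 360, 720, 1680, 2520, 5040 — the highly composite numbers where the
   margin is smallest, 1.1% at `n = 12`, 2.5% at `n = 5040`), `E ≤ D h`, `F (m+1) ≤ D a b`, the
   kernel checks `σ(n) · D ≤ E + F (n+1)` for every `1 ≤ n ≤ 5040` against the last row with
   `m ≤ n` (`checkAll`, by `decide +kernel`, about 30 s). For this `σ` is computed by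
   `sigmaFast`: strip the primes `p ≤ 71` by trial division (`σ` is multiplicative,
   `σ(pᵃ) = 1 + p + ⋯ + pᵃ`); the cofactor of an `n ≤ 5040 < 73²` is then `1` or a prime `q`
   (`σ(q) = q + 1`). `sigmaFast_eq` proves `sigmaFast n = σ 1 n` for `1 ≤ n ≤ 5040`.

## Source

* J. C. Lagarias, *An elementary problem equivalent to the Riemann hypothesis*, Amer. Math.
  Monthly 109 (2002), 534–543 (arXiv:math/0008177), §3, proof of Thm. 1.1 (the sentence quoted
  above). [cite: Lagarias2002, §3, proof of Thm. 1.1]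
-/

namespace Literature.NumberTheory.LFunctions

namespace LagariasNumerical

open ArithmeticFunction Finset Real
open scoped ArithmeticFunction.sigma

/-! ### A kernel-friendly evaluation of `σ` on `[1, 5040]` -/

/-- The primes below `73`. [folklore] -/
def smallPrimes : List ℕ :=
  [2, 3, 5, 7, 11, 13, 17, 19, 23, 29, 31, 37, 41, 43, 47, 53, 59, 61, 67, 71]

/-- `extract p fuel r = (1 + p + ⋯ + pᵃ, r / pᵃ)` where `pᵃ ‖ r` (for `fuel > a`, `r > 0`).
[folklore] -/
def extract (p : ℕ) : ℕ → ℕ → ℕ × ℕ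
  | 0, r => (1, r)
  | fuel + 1, r =>
    if 0 < r ∧ r % p = 0 then (p * (extract p fuel (r / p)).1 + 1, (extract p fuel (r / p)).2)
    else (1, r)

/-- Fold of `extract` over a list of primes; the final cofactor `r` contributes `1` if `r = 1`
and `r + 1` otherwise (correct when that cofactor is prime). [folklore] -/
def sigmaGo : List ℕ → ℕ → ℕ
  | [], r => if r = 1 then 1 else r + 1
  | p :: ps, r => (extract p 13 r).1 * sigmaGo ps (extract p 13 r).2

/-- `σ(n)` for `1 ≤ n ≤ 5040` (see `sigmaFast_eq`), by trial division over `smallPrimes`.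
[folklore] -/
def sigmaFast (n : ℕ) : ℕ :=
  sigmaGo smallPrimes n

/-- Specification of `extract`. [folklore] -/
theorem extract_spec {p : ℕ} (hp : 2 ≤ p) : ∀ (fuel r : ℕ), 0 < r → r < p ^ fuel →
    ∃ a : ℕ, r = p ^ a * (extract p fuel r).2 ∧ ¬ p ∣ (extract p fuel r).2 ∧
      (extract p fuel r).1 = ∑ i ∈ range (a + 1), p ^ i
  | 0, r, hr, hlt => by simp at hlt; omega
  | fuel + 1, r, hr, hlt => by
    have hp0 : 0 < p := by omega
    by_cases hdvd : r % p = 0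
    · have hcond : 0 < r ∧ r % p = 0 := ⟨hr, hdvd⟩
      simp only [extract, hcond, and_self, if_true]
      have hdvd' : p ∣ r := Nat.dvd_of_mod_eq_zero hdvd
      have hr' : 0 < r / p := Nat.div_pos (Nat.le_of_dvd hr hdvd') hp0
      have hlt' : r / p < p ^ fuel := by
        rw [Nat.div_lt_iff_lt_mul hp0]
        simpa [pow_succ] using hlt
      obtain ⟨a, h1, h2, h3⟩ := extract_spec hp fuel (r / p) hr' hlt'
      refine ⟨a + 1, ?_, h2, ?_⟩
      · calc r = p * (r / p) := (Nat.mul_div_cancel' hdvd').symm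
          _ = p * (p ^ a * (extract p fuel (r / p)).2) := by rw [← h1]
          _ = p ^ (a + 1) * (extract p fuel (r / p)).2 := by ring
      · rw [h3, Finset.sum_range_succ' (fun i => p ^ i) (a + 1), Finset.mul_sum]
        simp [pow_succ, mul_comm]
    · have hcond : ¬ (0 < r ∧ r % p = 0) := fun h => hdvd h.2
      simp only [extract, hcond, if_false]
      refine ⟨0, by simp, fun h => hdvd (Nat.mod_eq_zero_of_dvd h), by simp⟩

/-- Specification of `sigmaGo`: if every prime factor of `0 < r ≤ 5040` is in the prime list
`ps` or is at least `73`, then `sigmaGo ps r = σ r`. [folklore] -/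
theorem sigmaGo_spec : ∀ (ps : List ℕ) (r : ℕ), (∀ p ∈ ps, p.Prime) → 0 < r → r ≤ 5040 →
    (∀ q : ℕ, q.Prime → q ∣ r → q ∈ ps ∨ 73 ≤ q) → sigmaGo ps r = σ 1 r
  | [], r, _, hr, hr', hq => by
    simp only [sigmaGo]
    split_ifs with h1
    · subst h1
      simp
    · have hprime : r.Prime := by
        by_contra hnp
        have hmf := Nat.minFac_prime h1
        have h73 : 73 ≤ r.minFac := by
          rcases hq _ hmf (Nat.minFac_dvd r) with h | h
          · simp at h
          · exact h
        have hsq := Nat.minFac_sq_le_self hr hnp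
        nlinarith
      have := sigma_one_apply_prime_pow (i := 1) hprime
      rw [pow_one] at this
      rw [this]
      simp [Finset.sum_range_succ, add_comm]
  | p :: ps, r, hps, hr, hr', hq => by
    simp only [sigmaGo]
    have hp : p.Prime := hps p (by simp)
    have hp2 : 2 ≤ p := hp.two_le
    have hfuel : r < p ^ 13 :=
      lt_of_le_of_lt hr' (lt_of_lt_of_le (by norm_num) (Nat.pow_le_pow_left hp2 13))
    obtain ⟨a, h1, h2, h3⟩ := extract_spec hp2 13 r hr hfuel
    set r' := (extract p 13 r).2 with hr'def
    have hr'0 : 0 < r' := by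
      rcases Nat.eq_zero_or_pos r' with h | h
      · rw [h, mul_zero] at h1; omega
      · exact h
    have hr'le : r' ≤ 5040 := le_trans (Nat.le_of_dvd hr ⟨p ^ a, by rw [h1]; ring⟩) hr'
    have hcop : Nat.Coprime (p ^ a) r' :=
      Nat.Coprime.pow_left a ((Nat.Prime.coprime_iff_not_dvd hp).2 h2)
    have IH := sigmaGo_spec ps r' (fun q hq' => hps q (by simp [hq'])) hr'0 hr'le ?_
    · rw [IH, h3]
      conv_rhs => rw [h1]
      rw [isMultiplicative_sigma.map_mul_of_coprime hcop, sigma_one_apply_prime_pow hp]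
    · intro q hqp hqd
      have hqr : q ∣ r := h1 ▸ dvd_mul_of_dvd_right hqd _
      rcases hq q hqp hqr with hmem | h73
      · simp only [List.mem_cons] at hmem
        rcases hmem with rfl | hmem
        · exact absurd hqd h2
        · exact Or.inl hmem
      · exact Or.inr h73

/-- Every prime below `73` is in `smallPrimes` (stated without primality, so that `decide` only
does trial divisions). [folklore] -/
theorem mem_smallPrimes_or_exists_dvd :
    ∀ q < 73, 2 ≤ q → q ∈ smallPrimes ∨ ∃ d ∈ Finset.Ico 2 q, d ∣ q := by
  decide

/-- The entries of `smallPrimes` are prime. [folklore] -/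
theorem prime_of_mem_smallPrimes : ∀ p ∈ smallPrimes, p.Prime := by
  simp only [smallPrimes, List.forall_mem_cons]
  norm_num

/-- `sigmaFast` computes `σ` on `[1, 5040]`. [folklore] -/
theorem sigmaFast_eq {n : ℕ} (hn : 0 < n) (hn' : n ≤ 5040) : sigmaFast n = σ 1 n := by
  refine sigmaGo_spec smallPrimes n prime_of_mem_smallPrimes hn hn' ?_
  intro q hq _
  by_cases h73 : 73 ≤ q
  · exact Or.inr h73
  · rcases mem_smallPrimes_or_exists_dvd q (by omega) hq.two_le with h | ⟨d, hd, hdq⟩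
    · exact Or.inl h
    · rw [Finset.mem_Ico] at hd
      rcases (Nat.dvd_prime hq).1 hdq with rfl | rfl <;> omega

/-! ### The table and the integer check -/

/-- The common denominator of the table. [folklore] -/
def D : ℕ := 10000

/-- Rows `(m, E, F)`: for `n ≥ m`, `E + F (n+1) ≤ D · f(n)` (see `table_valid`); the checkpoints
`m` are the highly composite numbers up to `5040`. [cite: Lagarias2002, §3, proof of Thm. 1.1] -/
def table : List (ℕ × ℕ × ℕ) :=
  [(1, 10000, 0), (2, 15000, 6056), (3, 18333, 9476), (4, 20833, 11789), (6, 24500, 14834),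
    (12, 31032, 19398), (24, 37759, 23192), (36, 41745, 25108), (60, 46798, 27261),
    (120, 53647, 29674), (180, 57674, 30953), (360, 64578, 32950), (720, 71496, 34747),
    (1680, 79961, 36724), (2520, 84014, 37598), (5040, 90943, 38997)]

/-- The last row `(m, E, F)` of `table` with `m ≤ n`. [folklore] -/
def findRow (n : ℕ) : Option (ℕ × ℕ × ℕ) :=
  table.reverse.find? (fun c => c.1 ≤ n)

/-- The check at `n`: `sigmaFast n · D ≤ E + F (n+1)` for the row of `n`. [folklore] -/
def checkN (n : ℕ) : Bool :=
  match findRow n with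
  | none => false
  | some c => sigmaFast n * D ≤ c.2.1 + c.2.2 * (n + 1)

set_option maxRecDepth 20000 in
/-- The integer check for all `1 ≤ n ≤ 5040`, evaluated by the kernel (about 30 s).
[cite: Lagarias2002, §3, proof of Thm. 1.1 ("one verifies (1.1) directly by computer")] -/
theorem checkAll : (List.range' 1 5040).all checkN = true := by
  decide +kernel

/-! ### Real-analytic lemmas -/

/-- `harmonic` is monotone. [folklore] -/
theorem harmonic_mono {m n : ℕ} (h : m ≤ n) : harmonic m ≤ harmonic n := by
  simp only [harmonic]
  exact Finset.sum_le_sum_of_subset_of_nonneg (Finset.range_mono h) fun _ _ _ => by positivity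

/-- `exp(H_n)/(n+1)` is non-decreasing (since `exp(1/(n+1)) ≥ 1 + 1/(n+1)`). [folklore] -/
theorem exp_harmonic_div_succ_mono {m n : ℕ} (h : m ≤ n) :
    exp (harmonic m : ℝ) / (m + 1) ≤ exp (harmonic n : ℝ) / (n + 1) := by
  induction n, h using Nat.le_induction with
  | base => exact le_rfl
  | succ k _ ih =>
    refine ih.trans ?_
    rw [harmonic_succ]
    push_cast
    rw [exp_add]
    have hk : (0 : ℝ) < k + 1 := by positivity
    have he : 1 + ((k : ℝ) + 1)⁻¹ ≤ exp (((k : ℝ) + 1)⁻¹) := by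
      have := add_one_le_exp ((k : ℝ) + 1)⁻¹
      linarith
    rw [div_le_div_iff₀ hk (by positivity)]
    have hid : (k : ℝ) + 1 + 1 = (1 + ((k : ℝ) + 1)⁻¹) * ((k : ℝ) + 1) := by
      field_simp
    rw [hid]
    calc exp (harmonic k : ℝ) * ((1 + ((k : ℝ) + 1)⁻¹) * ((k : ℝ) + 1))
        = exp (harmonic k : ℝ) * (1 + ((k : ℝ) + 1)⁻¹) * ((k : ℝ) + 1) := by ring
      _ ≤ exp (harmonic k : ℝ) * exp (((k : ℝ) + 1)⁻¹) * ((k : ℝ) + 1) := by gcongr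

/-- **Checkpoint bound.** If `h ≤ H_m`, `1 ≤ h`, `a ≤ exp h`, `0 ≤ b ≤ log h`, then for every
`n ≥ m`, `h + a b (n+1)/(m+1) ≤ H_n + exp(H_n) log(H_n)`. [folklore] -/
theorem bound_of_checkpoint {m : ℕ} {h a b : ℝ} (hh : h ≤ harmonic m) (h1 : 1 ≤ h)
    (ha : a ≤ exp h) (hb : b ≤ log h) (hb0 : 0 ≤ b) {n : ℕ} (hn : m ≤ n) :
    h + a * b * (n + 1) / (m + 1) ≤
      (harmonic n : ℝ) + exp (harmonic n : ℝ) * log (harmonic n : ℝ) := by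
  have hHm : ((harmonic m : ℚ) : ℝ) ≤ harmonic n := by exact_mod_cast harmonic_mono hn
  have hHn : h ≤ harmonic n := hh.trans hHm
  have hexp : a * (n + 1) / (m + 1) ≤ exp (harmonic n : ℝ) := by
    have h2 := exp_harmonic_div_succ_mono hn
    have h3 : a ≤ exp (harmonic m : ℝ) := ha.trans (exp_le_exp.2 hh)
    have hn0 : (0 : ℝ) < n + 1 := by positivity
    calc a * (n + 1) / (m + 1) = a / (m + 1) * (n + 1) := by ring
      _ ≤ exp (harmonic m : ℝ) / (m + 1) * (n + 1) := by gcongr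
      _ ≤ exp (harmonic n : ℝ) / (n + 1) * (n + 1) := by gcongr
      _ = exp (harmonic n : ℝ) := by field_simp
  have hlog : b ≤ log (harmonic n : ℝ) := hb.trans (log_le_log (by linarith) hHn)
  calc h + a * b * (n + 1) / (m + 1) = h + a * (n + 1) / (m + 1) * b := by ring
    _ ≤ (harmonic n : ℝ) + exp (harmonic n : ℝ) * log (harmonic n : ℝ) :=
      add_le_add hHn (mul_le_mul hexp hlog hb0 (exp_pos _).le)

/-- Degree-11 Taylor polynomial of `exp`. [folklore] -/
noncomputable def taylorP (y : ℝ) : ℝ :=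
  1 + y + y ^ 2 / 2 + y ^ 3 / 6 + y ^ 4 / 24 + y ^ 5 / 120 + y ^ 6 / 720 + y ^ 7 / 5040 +
    y ^ 8 / 40320 + y ^ 9 / 362880 + y ^ 10 / 3628800 + y ^ 11 / 39916800

/-- `taylorP` plus the remainder bound of `Real.exp_bound'` with `n = 12`. [folklore] -/
noncomputable def taylorQ (y : ℝ) : ℝ :=
  taylorP y + y ^ 12 * 13 / (479001600 * 12)

/-- `taylorP` is the partial sum `Σ_{i<12} yⁱ/i!`. [folklore] -/
theorem taylorP_eq (y : ℝ) : taylorP y = ∑ i ∈ range 12, y ^ i / i.factorial := by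
  simp only [taylorP, Finset.sum_range_succ, Finset.sum_range_zero, Nat.factorial]
  norm_num

/-- `taylorQ` is the right-hand side of `Real.exp_bound'` with `n = 12`. [folklore] -/
theorem taylorQ_eq (y : ℝ) : taylorQ y = (∑ i ∈ range 12, y ^ i / i.factorial) +
    y ^ 12 * ((12 : ℕ) + 1) / ((Nat.factorial 12 : ℕ) * (12 : ℕ)) := by
  rw [taylorQ, taylorP_eq]
  simp only [Nat.factorial]
  norm_num

/-- Certified lower bound: `a ≤ 2.7182818283^j · taylorP y` and `x = j + y`, `y ≥ 0` give
`a ≤ exp x`. [folklore] -/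
theorem le_exp_of_taylor (j : ℕ) (y : ℝ) {x a : ℝ} (hx : x = j + y) (hy : 0 ≤ y)
    (ha : a ≤ (2.7182818283 : ℝ) ^ j * taylorP y) : a ≤ exp x := by
  rw [hx, exp_add]
  have h1 : (2.7182818283 : ℝ) ^ j ≤ exp j := by
    calc (2.7182818283 : ℝ) ^ j ≤ (exp 1) ^ j := pow_le_pow_left₀ (by norm_num) exp_one_gt_d9.le j
      _ = exp j := by rw [← exp_nat_mul, mul_one]
  have h2 : taylorP y ≤ exp y := by
    rw [taylorP_eq]
    exact sum_le_exp_of_nonneg hy 12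
  have h3 : 0 ≤ taylorP y := by
    simp only [taylorP]
    positivity
  exact ha.trans (mul_le_mul h1 h2 h3 (exp_pos _).le)

/-- Certified upper bound: `x = j + y`, `0 ≤ y ≤ 1` and `2.7182818286^j · taylorQ y ≤ t` give
`exp x ≤ t`. [folklore] -/
theorem exp_le_of_taylor (j : ℕ) (y : ℝ) {x t : ℝ} (hx : x = j + y) (hy0 : 0 ≤ y) (hy1 : y ≤ 1)
    (ht : (2.7182818286 : ℝ) ^ j * taylorQ y ≤ t) : exp x ≤ t := by
  rw [hx, exp_add]
  have h1 : exp j ≤ (2.7182818286 : ℝ) ^ j := by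
    calc exp j = (exp 1) ^ j := by rw [← exp_nat_mul, mul_one]
      _ ≤ (2.7182818286 : ℝ) ^ j := pow_le_pow_left₀ (exp_pos _).le exp_one_lt_d9.le j
  have h2 : exp y ≤ taylorQ y := by
    rw [taylorQ_eq]
    exact exp_bound' hy0 hy1 (by norm_num)
  exact le_trans (mul_le_mul h1 h2 (exp_pos _).le (by positivity)) ht

/-- `H_m ≥ hk + l` from `hk ≤ H_k`, `k ≤ m` and `exp l ≤ (m+1)/(k+1)` (monotonicity of
`eulerMascheroniSeq n = H_n − log(n+1)`). [folklore] -/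
theorem harmonic_lower_of_le {k m : ℕ} (hkm : k ≤ m) {hk : ℝ} (h1 : hk ≤ harmonic k) {l : ℝ}
    (h2 : exp l ≤ ((m : ℝ) + 1) / ((k : ℝ) + 1)) : hk + l ≤ harmonic m := by
  have hmono := strictMono_eulerMascheroniSeq.monotone hkm
  simp only [eulerMascheroniSeq] at hmono
  have hk0 : (0 : ℝ) < k + 1 := by positivity
  have hm0 : (0 : ℝ) < m + 1 := by positivity
  have hl : l ≤ log ((m : ℝ) + 1) - log ((k : ℝ) + 1) := by
    rw [← log_div hm0.ne' hk0.ne', le_log_iff_exp_le (by positivity)]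
    exact h2
  linarith

/-! ### The sixteen rows -/

/-- Exact rational lower bound for `H_2` (unfolding `harmonic`). [folklore] -/
theorem harmonic_ge_2 : (3/2 : ℝ) ≤ (harmonic 2 : ℚ) := by
  have h : (3/2 : ℚ) ≤ harmonic 2 := by
    simp only [harmonic, Finset.sum_range_succ, Finset.sum_range_zero]; norm_num
  have h' : ((3/2 : ℚ) : ℝ) ≤ (harmonic 2 : ℚ) := Rat.cast_le.2 h
  simpa using h'

/-- Exact rational lower bound for `H_3` (unfolding `harmonic`). [folklore] -/
theorem harmonic_ge_3 : (1833333/1000000 : ℝ) ≤ (harmonic 3 : ℚ) := by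
  have h : (1833333/1000000 : ℚ) ≤ harmonic 3 := by
    simp only [harmonic, Finset.sum_range_succ, Finset.sum_range_zero]; norm_num
  have h' : ((1833333/1000000 : ℚ) : ℝ) ≤ (harmonic 3 : ℚ) := Rat.cast_le.2 h
  simpa using h'

/-- Exact rational lower bound for `H_4` (unfolding `harmonic`). [folklore] -/
theorem harmonic_ge_4 : (2083333/1000000 : ℝ) ≤ (harmonic 4 : ℚ) := by
  have h : (2083333/1000000 : ℚ) ≤ harmonic 4 := by
    simp only [harmonic, Finset.sum_range_succ, Finset.sum_range_zero]; norm_num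
  have h' : ((2083333/1000000 : ℚ) : ℝ) ≤ (harmonic 4 : ℚ) := Rat.cast_le.2 h
  simpa using h'

/-- Exact rational lower bound for `H_6` (unfolding `harmonic`). [folklore] -/
theorem harmonic_ge_6 : (49/20 : ℝ) ≤ (harmonic 6 : ℚ) := by
  have h : (49/20 : ℚ) ≤ harmonic 6 := by
    simp only [harmonic, Finset.sum_range_succ, Finset.sum_range_zero]; norm_num
  have h' : ((49/20 : ℚ) : ℝ) ≤ (harmonic 6 : ℚ) := Rat.cast_le.2 h
  simpa using h'

/-- Exact rational lower bound for `H_12` (unfolding `harmonic`). [folklore] -/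
theorem harmonic_ge_12 : (310321/100000 : ℝ) ≤ (harmonic 12 : ℚ) := by
  have h : (310321/100000 : ℚ) ≤ harmonic 12 := by
    simp only [harmonic, Finset.sum_range_succ, Finset.sum_range_zero]; norm_num
  have h' : ((310321/100000 : ℚ) : ℝ) ≤ (harmonic 12 : ℚ) := Rat.cast_le.2 h
  simpa using h'

/-- Exact rational lower bound for `H_24` (unfolding `harmonic`). [folklore] -/
theorem harmonic_ge_24 : (1887979/500000 : ℝ) ≤ (harmonic 24 : ℚ) := by
  have h : (1887979/500000 : ℚ) ≤ harmonic 24 := by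
    simp only [harmonic, Finset.sum_range_succ, Finset.sum_range_zero]; norm_num
  have h' : ((1887979/500000 : ℚ) : ℝ) ≤ (harmonic 24 : ℚ) := Rat.cast_le.2 h
  simpa using h'

/-- Exact rational lower bound for `H_36` (unfolding `harmonic`). [folklore] -/
theorem harmonic_ge_36 : (4174559/1000000 : ℝ) ≤ (harmonic 36 : ℚ) := by
  have h : (4174559/1000000 : ℚ) ≤ harmonic 36 := by
    simp only [harmonic, Finset.sum_range_succ, Finset.sum_range_zero]; norm_num
  have h' : ((4174559/1000000 : ℚ) : ℝ) ≤ (harmonic 36 : ℚ) := Rat.cast_le.2 h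
  simpa using h'

/-- Exact rational lower bound for `H_60` (unfolding `harmonic`). [folklore] -/
theorem harmonic_ge_60 : (467987/100000 : ℝ) ≤ (harmonic 60 : ℚ) := by
  have h : (467987/100000 : ℚ) ≤ harmonic 60 := by
    simp only [harmonic, Finset.sum_range_succ, Finset.sum_range_zero]; norm_num
  have h' : ((467987/100000 : ℚ) : ℝ) ≤ (harmonic 60 : ℚ) := Rat.cast_le.2 h
  simpa using h'

/-- Validity of a row `(m, E, F)`: `(E + F (n+1))/D ≤ f(n)` for all `n ≥ m`. [folklore] -/
def RowValid (c : ℕ × ℕ × ℕ) : Prop :=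
  ∀ n : ℕ, c.1 ≤ n →
    ((c.2.1 : ℝ) + c.2.2 * (n + 1)) / D ≤
      (harmonic n : ℝ) + exp (harmonic n : ℝ) * log (harmonic n : ℝ)

/-- A row is valid once certified constants `h, a, b` are supplied. [folklore] -/
theorem rowValid_of {m E F : ℕ} {h a b : ℝ} (hh : h ≤ harmonic m) (h1 : 1 ≤ h)
    (ha : a ≤ exp h) (hb : b ≤ log h) (hb0 : 0 ≤ b) (hE : (E : ℝ) ≤ 10000 * h)
    (hF : (F : ℝ) * (m + 1) ≤ 10000 * (a * b)) : RowValid (m, E, F) := by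
  intro n hn
  have key := bound_of_checkpoint hh h1 ha hb hb0 hn
  have hm0 : (0 : ℝ) < m + 1 := by positivity
  have hF' : (F : ℝ) ≤ 10000 * (a * b) / (m + 1) := by
    rw [le_div_iff₀ hm0]
    exact hF
  have hn0 : (0 : ℝ) ≤ n + 1 := by positivity
  calc (((E : ℕ) : ℝ) + (F : ℕ) * (n + 1)) / D
      ≤ (10000 * h + 10000 * (a * b) / (m + 1) * (n + 1)) / D := by
        simp only [D, Nat.cast_ofNat]
        gcongr
    _ = h + a * b * (n + 1) / (m + 1) := by
        simp only [D, Nat.cast_ofNat]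
        field_simp
    _ ≤ _ := key

/-- All sixteen rows are valid (the certified real inequalities). [folklore] -/
theorem table_valid : ∀ c ∈ table, RowValid c := by
  simp only [table, List.mem_cons, List.not_mem_nil, or_false, forall_eq_or_imp, forall_eq]
  refine ⟨?_, ?_, ?_, ?_, ?_, ?_, ?_, ?_, ?_, ?_, ?_, ?_, ?_, ?_, ?_, ?_⟩
  · -- m = 1
    exact rowValid_of (m := 1) (h := 1) (a := 0) (b := 0) (by simp) le_rfl (exp_pos _).le (by simp)
      le_rfl (by norm_num) (by norm_num)
  · -- m = 2
    exact rowValid_of (m := 2) (h := 3/2) (a := 4481/1000) (b := 81093/200000)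
      harmonic_ge_2
      (by norm_num)
      (le_exp_of_taylor 1 (1/2) (by norm_num) (by norm_num) (by norm_num [taylorP]))
      ((le_log_iff_exp_le (by norm_num)).2
        (exp_le_of_taylor 0 (81093/200000) (by norm_num) (by norm_num) (by norm_num)
          (by norm_num [taylorQ, taylorP])))
      (by norm_num) (by norm_num) (by norm_num)
  · -- m = 3
    exact rowValid_of (m := 3) (h := 1833333/1000000) (a := 3127/500) (b := 121227/200000)
      harmonic_ge_3
      (by norm_num)
      (le_exp_of_taylor 1 (833333/1000000) (by norm_num) (by norm_num) (by norm_num [taylorP]))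
      ((le_log_iff_exp_le (by norm_num)).2
        (exp_le_of_taylor 0 (121227/200000) (by norm_num) (by norm_num) (by norm_num)
          (by norm_num [taylorQ, taylorP])))
      (by norm_num) (by norm_num) (by norm_num)
  · -- m = 4
    exact rowValid_of (m := 4) (h := 2083333/1000000) (a := 8031/1000) (b := 733969/1000000)
      harmonic_ge_4
      (by norm_num)
      (le_exp_of_taylor 2 (83333/1000000) (by norm_num) (by norm_num) (by norm_num [taylorP]))
      ((le_log_iff_exp_le (by norm_num)).2
        (exp_le_of_taylor 0 (733969/1000000) (by norm_num) (by norm_num) (by norm_num)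
          (by norm_num [taylorQ, taylorP])))
      (by norm_num) (by norm_num) (by norm_num)
  · -- m = 6
    exact rowValid_of (m := 6) (h := 49/20) (a := 2897/250) (b := 112011/125000)
      harmonic_ge_6
      (by norm_num)
      (le_exp_of_taylor 2 (9/20) (by norm_num) (by norm_num) (by norm_num [taylorP]))
      ((le_log_iff_exp_le (by norm_num)).2
        (exp_le_of_taylor 0 (112011/125000) (by norm_num) (by norm_num) (by norm_num)
          (by norm_num [taylorQ, taylorP])))
      (by norm_num) (by norm_num) (by norm_num)
  · -- m = 12
    exact rowValid_of (m := 12) (h := 310321/100000) (a := 22269/1000) (b := 1132437/1000000)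
      harmonic_ge_12
      (by norm_num)
      (le_exp_of_taylor 3 (10321/100000) (by norm_num) (by norm_num) (by norm_num [taylorP]))
      ((le_log_iff_exp_le (by norm_num)).2
        (exp_le_of_taylor 1 (132437/1000000) (by norm_num) (by norm_num) (by norm_num)
          (by norm_num [taylorQ, taylorP])))
      (by norm_num) (by norm_num) (by norm_num)
  · -- m = 24
    exact rowValid_of (m := 24) (h := 1887979/500000) (a := 43639/1000) (b := 664327/500000)
      harmonic_ge_24
      (by norm_num)
      (le_exp_of_taylor 3 (387979/500000) (by norm_num) (by norm_num) (by norm_num [taylorP]))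
      ((le_log_iff_exp_le (by norm_num)).2
        (exp_le_of_taylor 1 (164327/500000) (by norm_num) (by norm_num) (by norm_num)
          (by norm_num [taylorQ, taylorP])))
      (by norm_num) (by norm_num) (by norm_num)
  · -- m = 36
    exact rowValid_of (m := 36) (h := 4174559/1000000) (a := 65011/1000) (b := 89313/62500)
      harmonic_ge_36
      (by norm_num)
      (le_exp_of_taylor 4 (174559/1000000) (by norm_num) (by norm_num) (by norm_num [taylorP]))
      ((le_log_iff_exp_le (by norm_num)).2
        (exp_le_of_taylor 1 (26813/62500) (by norm_num) (by norm_num) (by norm_num)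
          (by norm_num [taylorQ, taylorP])))
      (by norm_num) (by norm_num) (by norm_num)
  · -- m = 60
    exact rowValid_of (m := 60) (h := 467987/100000) (a := 26939/250) (b := 154327/100000)
      harmonic_ge_60
      (by norm_num)
      (le_exp_of_taylor 4 (67987/100000) (by norm_num) (by norm_num) (by norm_num [taylorP]))
      ((le_log_iff_exp_le (by norm_num)).2
        (exp_le_of_taylor 1 (54327/100000) (by norm_num) (by norm_num) (by norm_num)
          (by norm_num [taylorQ, taylorP])))
      (by norm_num) (by norm_num) (by norm_num)
  · -- m = 120
    exact rowValid_of (m := 120) (h := 467987/100000 + 171229/250000)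
      (a := 42749/200) (b := 104991/62500)
      (harmonic_lower_of_le (k := 60) (m := 120) (by norm_num) harmonic_ge_60
        (exp_le_of_taylor 0 (171229/250000) (by norm_num) (by norm_num) (by norm_num)
          (by norm_num [taylorQ, taylorP])))
      (by norm_num)
      (le_exp_of_taylor 5 (182393/500000) (by norm_num) (by norm_num) (by norm_num [taylorP]))
      ((le_log_iff_exp_le (by norm_num)).2
        (exp_le_of_taylor 1 (42491/62500) (by norm_num) (by norm_num) (by norm_num)
          (by norm_num [taylorQ, taylorP])))
      (by norm_num) (by norm_num) (by norm_num)
  · -- m = 180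
    exact rowValid_of (m := 180) (h := 467987/100000 + 1087623/1000000)
      (a := 63947/200) (b := 1752237/1000000)
      (harmonic_lower_of_le (k := 60) (m := 180) (by norm_num) harmonic_ge_60
        (exp_le_of_taylor 1 (87623/1000000) (by norm_num) (by norm_num) (by norm_num)
          (by norm_num [taylorQ, taylorP])))
      (by norm_num)
      (le_exp_of_taylor 5 (767493/1000000) (by norm_num) (by norm_num) (by norm_num [taylorP]))
      ((le_log_iff_exp_le (by norm_num)).2
        (exp_le_of_taylor 1 (752237/1000000) (by norm_num) (by norm_num) (by norm_num)
          (by norm_num [taylorQ, taylorP])))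
      (by norm_num) (by norm_num) (by norm_num)
  · -- m = 360
    exact rowValid_of (m := 360) (h := 467987/100000 + 444501/250000)
      (a := 637703/1000) (b := 18653/10000)
      (harmonic_lower_of_le (k := 60) (m := 360) (by norm_num) harmonic_ge_60
        (exp_le_of_taylor 1 (194501/250000) (by norm_num) (by norm_num) (by norm_num)
          (by norm_num [taylorQ, taylorP])))
      (by norm_num)
      (le_exp_of_taylor 6 (228937/500000) (by norm_num) (by norm_num) (by norm_num [taylorP]))
      ((le_log_iff_exp_le (by norm_num)).2
        (exp_le_of_taylor 1 (8653/10000) (by norm_num) (by norm_num) (by norm_num)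
          (by norm_num [taylorQ, taylorP])))
      (by norm_num) (by norm_num) (by norm_num)
  · -- m = 720
    exact rowValid_of (m := 720) (h := 467987/100000 + 493953/200000)
      (a := 31841/25) (b := 1967061/1000000)
      (harmonic_lower_of_le (k := 60) (m := 720) (by norm_num) harmonic_ge_60
        (exp_le_of_taylor 2 (93953/200000) (by norm_num) (by norm_num) (by norm_num)
          (by norm_num [taylorQ, taylorP])))
      (by norm_num)
      (le_exp_of_taylor 7 (29927/200000) (by norm_num) (by norm_num) (by norm_num [taylorP]))
      ((le_log_iff_exp_le (by norm_num)).2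
        (exp_le_of_taylor 1 (967061/1000000) (by norm_num) (by norm_num) (by norm_num)
          (by norm_num [taylorQ, taylorP])))
      (by norm_num) (by norm_num) (by norm_num)
  · -- m = 1680
    exact rowValid_of (m := 1680) (h := 467987/100000 + 331627/100000)
      (a := 2969473/1000) (b := 1039479/500000)
      (harmonic_lower_of_le (k := 60) (m := 1680) (by norm_num) harmonic_ge_60
        (exp_le_of_taylor 3 (31627/100000) (by norm_num) (by norm_num) (by norm_num)
          (by norm_num [taylorQ, taylorP])))
      (by norm_num)
      (le_exp_of_taylor 7 (49807/50000) (by norm_num) (by norm_num) (by norm_num [taylorP]))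
      ((le_log_iff_exp_le (by norm_num)).2
        (exp_le_of_taylor 2 (39479/500000) (by norm_num) (by norm_num) (by norm_num)
          (by norm_num [taylorQ, taylorP])))
      (by norm_num) (by norm_num) (by norm_num)
  · -- m = 2520
    exact rowValid_of (m := 2520) (h := 467987/100000 + 3721537/1000000)
      (a := 556666/125) (b := 2128399/1000000)
      (harmonic_lower_of_le (k := 60) (m := 2520) (by norm_num) harmonic_ge_60
        (exp_le_of_taylor 3 (721537/1000000) (by norm_num) (by norm_num) (by norm_num)
          (by norm_num [taylorQ, taylorP])))
      (by norm_num)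
      (le_exp_of_taylor 8 (401407/1000000) (by norm_num) (by norm_num) (by norm_num [taylorP]))
      ((le_log_iff_exp_le (by norm_num)).2
        (exp_le_of_taylor 2 (128399/1000000) (by norm_num) (by norm_num) (by norm_num)
          (by norm_num [taylorQ, taylorP])))
      (by norm_num) (by norm_num) (by norm_num)
  · -- m = 5040
    exact rowValid_of (m := 5040) (h := 467987/100000 + 882897/200000)
      (a := 4452441/500) (b := 2207653/1000000)
      (harmonic_lower_of_le (k := 60) (m := 5040) (by norm_num) harmonic_ge_60
        (exp_le_of_taylor 4 (82897/200000) (by norm_num) (by norm_num) (by norm_num)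
          (by norm_num [taylorQ, taylorP])))
      (by norm_num)
      (le_exp_of_taylor 9 (18871/200000) (by norm_num) (by norm_num) (by norm_num [taylorP]))
      ((le_log_iff_exp_le (by norm_num)).2
        (exp_le_of_taylor 2 (207653/1000000) (by norm_num) (by norm_num) (by norm_num)
          (by norm_num [taylorQ, taylorP])))
      (by norm_num) (by norm_num) (by norm_num)

/-! ### Assembly -/

/-- **Lagarias 2002, proof of Thm. 1.1, the case `n ≤ 5040`** ("one verifies (1.1) directly by
computer"): for `1 ≤ n ≤ 5040`, `σ(n) ≤ H_n + exp(H_n) log(H_n)`.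
[cite: Lagarias2002, §3, proof of Thm. 1.1] -/
theorem _root_.Literature.NumberTheory.LFunctions.sigma_le_harmonic_add_exp_mul_log_of_le_5040 (n : ℕ) (hn : 1 ≤ n)
    (hn' : n ≤ 5040) :
    (σ 1 n : ℝ) ≤ (harmonic n : ℝ) + exp (harmonic n : ℝ) * log (harmonic n : ℝ) := by
  have hmem : n ∈ List.range' 1 5040 := by
    rw [List.mem_range'_1]
    omega
  have hc := List.all_eq_true.1 checkAll n hmem
  unfold checkN at hc
  cases hfind : findRow n with
  | none => simp [hfind] at hc
  | some c =>
    simp only [hfind, decide_eq_true_eq] at hc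
    have hcmem : c ∈ table := List.mem_reverse.1 (List.mem_of_find?_eq_some hfind)
    have hcle : c.1 ≤ n := by simpa using List.find?_some hfind
    have hv := table_valid c hcmem n hcle
    rw [sigmaFast_eq (by omega) hn'] at hc
    refine le_trans ?_ hv
    rw [le_div_iff₀ (by simp [D])]
    exact_mod_cast hc

end LagariasNumerical

end Literature.NumberTheory.LFunctions
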